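import Summits.QuantumFields.YangMills.Theorems.BalabanUVNodesN12RootTransporterBjB
import Summits.QuantumFields.YangMills.Theorems.BalabanUVNodesN12BjRootChainsLam
import HarnessLib

/-!
# BalabanUVNodes ∕ N12 — THE ROOT-TRANSPORTER LETTER `hT` AT PRINT's DATUM `Λ(Z) = lamBondsSeq (maxDomT M₁ Z) k` ([Balaban1984PropagatorsII] (2.3)): the §Record half of dag-n12-w3's
# `…N12RootTransporterBj` — `rootTransporter_Bj`, `rootTransporter_Bj_graded`, `hubLetters_Bj` — RE-KEYED so that the segment corr-factor letter `hκ`, the member-average letter `hδ₁` and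
# the (CENTRE) clause read PRINT members only (the bonds the (2.12) constraint pins), over dag-n12-d's generic `…N12RootTransporterBjB.transporter_of_links` and this seat's print root
# chains `…N12BjRootChainsLam` — O1 module (1) of the gauge-letter chain at print's datum (dag-n12-d CEDE ∕ dag-lead WORDS 426, pub-ymgap INBOX 2026-08-30)

[Balaban1984PropagatorsII] = «[II]», (2.3) p. 224 (print's `Λ_j`); [Balaban1985Variational] = «[15]», (3)–(4) p. 278, (16)–(18) p. 280 (the residual axial gauge between the points of `𝔅_k`);
[Balaban1985RegularSpaces] = «[6]», (1.7) p. 77, (1.19) p. 79; [Balaban1985Averaging], (19)–(20) p. 21 (transport along a segment vs. the block average); [Balaban1988Convergent] = «[III]»,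
(2.12)–(2.13) pp. 256–257; [Balaban1987RG1] = «[RG1]», (0.4) p. 253 (correction factors).

Cell `pub-ymgap` (HUMAN RULINGS D-0062 ∕ D-0149), lane `pub-ymgap-dag-n12-c` g37 (R134 seat (a), N12 = [B15], s1, lane owner; O1 by dag-n12-d's CEDE and dag-lead WORDS 426); `--kind proof
--supports` K1⁹ `stmt-QuantumFields-27364` `--as helper`; count-neutral.  THEOREMS ONLY (0 `def`, 0 `instance`, 0 `sorry`); the parent's proof texts (tree bytes, block-extracted by
`work/gen_roottransporter_lam.py`) with `bondsOf (𝐁_k(Z)_i) ↦ Λ_i(Z)` in the three displayed letters and the chain suppliers exchanged for their print editions; by name over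
`…N12RootTransporterBjB.transporter_of_links` (dag-n12-d ✓, generic bond datum `𝔅`), `…N12RootTransporterBj.theta_mono_of_nonneg` (datum-free, reused), `…N12BjRootChainsLam`
(`exists_rootChain_lamBondsSeq(_graded)`, `exists_chain_root_centre_lam`, `exists_chain_centre_centre_lam`), `…N12FlatHndRecordLetters.hcov_Bj`, `…N12BjCollarRoots.eq_of_iterBlockOf_mem_Bj`.
NEW: ★★★ `rootTransporter_lamBondsSeq_graded_touching` (bonds TOUCHING `Ω₁(Z)`, crossing bonds included; root map in the (CENTRE)ᴸᵃᵐ shape).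
DECL MAP (old → new, for dag-n12-d's `twinned.json`): `N12RootTransporterBj.rootTransporter_Bj ↦ N12RootTransporterBjLam.rootTransporter_lamBondsSeq`, `….rootTransporter_Bj_graded ↦
….rootTransporter_lamBondsSeq_graded`, `….hubLetters_Bj ↦ ….hubLetters_lamBondsSeq`; `theta_mono_of_nonneg`, `transporter_of_links` unchanged (parent ∕ `…B`).

WHY.  dag-n12-w6's interior-letter corridor reduces the localised gauge letter (σ)_N to `hT`; `hT` is inhabited by reading `U₀` along a chain of CONSTRAINED bonds, each segment within
`θ_i` of the block average `M^i(U₀)(c)`, itself `δ₁`-near `1` by the DATUM letter — which the (2.12) minimiser supplies only where it is constrained.  At print's datum that is `Λ(Z)`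
(the inward connectors are free variables of print's variational problem — the lane's LOCATED of 2026-08-30), so `hκ`∕`hδ₁` must be asked, and the chain must run, on print members:
`…N12BjRootChainsLam` supplies such chains with the parent's constants, and the proof is the parent's.

HONEST FRAMING.  Lattice ∕ group bookkeeping by name over landed kernel theorems; no estimate of Bałaban's asserted or refuted; `hκ`, `hδ₁`, the root map and the minimiser stay
DISPLAYED; count-neutral helper (`--supports 27364`); N12 NOT discharged; K0⁷∕K1⁹ NOT closed; counts of record unmoved (typed 28∕28 · discharged 8∕27); one finite 𝕋⁴ programme at
fixed ε — R4 closes the conditional rung `BalabanLadder.UV` only; the Yang–Mills mass gap (Clay) is NOT proved by any of this; nothing continuum ∕ ℝ⁴ ∕ OS.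
-/

noncomputable section

namespace Summit.QuantumFields.YangMills.BalabanUVNodes.N12RootTransporterBjLam

open scoped BigOperators
open Literature.MathematicalPhysics.QuantumFieldTheory.Balaban1983to89
open T4Continuum BlockAveraging
open B15DeterminingSets B15DeterminingSetsB
open B5Eq118OneStroke (iterBlockOf)
open B14.Eq213MaximalDomains (side)
open B14.Eq213DetSet (Bj Bj_zero maxDomT)
open Summit.QuantumFields.YangMills.BalabanUVNodes.N12FlatHndRecordLetters (hcov_Bj)
open Summit.QuantumFields.YangMills.BalabanUVNodes.N12RootTransporterBj (theta_mono_of_nonneg)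
open Summit.QuantumFields.YangMills.BalabanUVNodes.N12RootTransporterBjB (transporter_of_links)
open Summit.QuantumFields.YangMills.BalabanUVNodes.N12BjRootChainsLam (exists_rootChain_lamBondsSeq exists_rootChain_lamBondsSeq_graded
  exists_chain_root_centre_lam exists_chain_centre_centre_lam exists_rootChain_lamBondsSeq_graded_touching)

variable {P : Params} {G : Type*} [GaugeGroup G]

/-! ## The root-transporter letter at print's datum, from the print root chains -/

section Record

variable {M₁ k : ℕ} {Z : Set (Site P 0)}

/-- ★★★ **THE ROOT-TRANSPORTER LETTER `hT` AT PRINT's DATUM `Λ(Z) = lamBondsSeq (maxDomT M₁ Z) k`** — `N12RootTransporterBj.rootTransporter_Bj` binder for binder with the (CENTRE)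
clause, the segment corr-factor letter `hκ` and the member-average letter `hδ₁` read on PRINT members only (`c ∈ Λ_i(Z)`: exactly the bonds whose averages the (2.12) constraint
`M_Λ(U₀) = V` pins).  `1 ≤ k ≤ m + K`, `M₁ ≥ 2`, cover divisibility; any `GaugeGroup`, any small-loop average `ℰ`, any fine configuration `U`.  THEN for every fine bond `b` with both ends in
`Ω₁(Z)` and `root b₋ ≠ root b₊`: a fine word `Ω` from `root b₋` to `root b₊` of length `≤ m·L^k` and `g` with `dist1 (𝒰_U(walk (root b₋) Ω)·g⁻¹) ≤ m·θ_k`, `dist1 g ≤ m·δ₁`,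
`m = 3·d·(L−1)∕2 + 5` — the segments of the print root chain `…N12BjRootChainsLam.exists_rootChain_lamBondsSeq` read through n12-d's generic `…RootTransporterBjB.transporter_of_links`.
[cite: Balaban1984PropagatorsII, (2.3) p.224; Balaban1985Variational, (3)–(4) p.278, (16)–(18) p.280; Balaban1985RegularSpaces, (1.19) p.79; Balaban1985Averaging, (19)–(20) p.21; Balaban1988Convergent, (2.13) pp.256–257] -/
theorem rootTransporter_lamBondsSeq (hk : k ≤ P.m + P.K) (hk1 : 1 ≤ k) (hM2 : 2 ≤ M₁) (hdiv : side P.L M₁ k ∣ P.sitesPerDir 0) (root : Site P 0 → Site P 0)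
    (hcentre : ∀ (z : Site P 0) (J : ℕ), iterBlockOf J z ∈ (Bj M₁ Z k : DetSet P) J →
      ((1 ≤ J ∧ ∃ c ∈ lamBondsSeq (maxDomT M₁ Z) k (J - 1), (iterBlockOf (J - 1) z = c.src ∨ iterBlockOf (J - 1) z = c.tgt)) ∧
          root z = embIter (J - 1) (iterBlockOf (J - 1) z)) ∨
      (¬ (1 ≤ J ∧ ∃ c ∈ lamBondsSeq (maxDomT M₁ Z) k (J - 1), (iterBlockOf (J - 1) z = c.src ∨ iterBlockOf (J - 1) z = c.tgt)) ∧
          root z = embIter J (iterBlockOf J z)))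
    (ℰ : LoopAverage G) (U : GaugeField P 0 G) (κ θ : ℕ → ℝ) (hθ0 : 0 ≤ θ 0) (hθ : ∀ i, κ i + P.L * θ i ≤ θ (i + 1)) (hθk : ∀ i ≤ k, θ i ≤ θ k)
    (hκ : ∀ i ≤ k, ∀ c ∈ lamBondsSeq (maxDomT M₁ Z) k i, ∀ i' < i, ∀ c' : PBond P (i' + 1), c'.dir = c.dir →
      (∃ t < P.L ^ i, embIter (i' + 1) c'.src = (fun z : Site P 0 => z.shift c.dir)^[t] (embIter i c.src)) →
      dist1 (corr ℰ (Averaging.iter (fun i => blockAvg (P := P) (j := i) ℰ) i' U) c') ≤ κ i')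
    {δ₁ : ℝ} (hδ₁ : ∀ i ≤ k, ∀ c ∈ lamBondsSeq (maxDomT M₁ Z) k i, dist1 (Averaging.iter (fun i => blockAvg (P := P) (j := i) ℰ) i U c) ≤ δ₁) :
    ∀ b : PBond P 0, b.src ∈ maxDomT M₁ Z 1 → b.tgt ∈ maxDomT M₁ Z 1 → root b.src ≠ root b.tgt →
      ∃ (Ωw : List (Letter P.d)) (g : G), walkEnd (root b.src) Ωw = root b.tgt ∧ Ωw.length ≤ (3 * (P.d * ((P.L - 1) / 2)) + 5) * P.L ^ k ∧
        dist1 (holAt U (walk (root b.src) Ωw) * g⁻¹) ≤ ((3 * (P.d * ((P.L - 1) / 2)) + 5 : ℕ) : ℝ) * θ k ∧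
        dist1 g ≤ ((3 * (P.d * ((P.L - 1) / 2)) + 5 : ℕ) : ℝ) * δ₁ := by
  intro b hbs hbt hne
  obtain ⟨links, hlen, hmem, hend, hcons⟩ := exists_rootChain_lamBondsSeq hk hk1 hM2 hdiv root hcentre b hbs hbt
  obtain ⟨g, hH, hg, hl⟩ := transporter_of_links ℰ U κ θ hθ0 hθ hθk (lamBondsSeq (maxDomT M₁ Z) k) hκ hδ₁ (root b.src) links hmem (fun l hl => (hmem l hl).1) hcons
  have hθk0 : 0 ≤ θ k := hθ0.trans (hθk 0 (Nat.zero_le k))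
  have hδ0 : (0 : ℝ) ≤ δ₁ ∨ links = [] := by
    rcases links with _ | ⟨l, ls⟩
    · exact Or.inr rfl
    · exact Or.inl ((GaugeGroup.dist1_nonneg _).trans (hδ₁ l.1 (hmem l (by simp)).1 l.2.1 (hmem l (by simp)).2))
  have hlenR : (links.length : ℝ) ≤ ((3 * (P.d * ((P.L - 1) / 2)) + 5 : ℕ) : ℝ) := by exact_mod_cast hlen
  refine ⟨_, g, hend, hl.trans (Nat.mul_le_mul_right _ hlen), hH.trans (mul_le_mul_of_nonneg_right hlenR hθk0), hg.trans ?_⟩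
  rcases hδ0 with h0 | hnil
  · exact mul_le_mul_of_nonneg_right hlenR h0
  · -- an empty chain would mean `root b₋ = root b₊`
    subst hnil
    simp only [List.map_nil, List.flatten_nil, walkEnd] at hend
    exact absurd hend hne

/-- ★★★ **THE ROOT-TRANSPORTER LETTER AT PRINT's DATUM, GRADED BY THE LEVEL OF THE BOND** — `N12RootTransporterBj.rootTransporter_Bj_graded` with (CENTRE), `hκ`, `hδ₁` read on print
members: `θ` monotone; for a fine bond `b` inside `Ω₁(Z)` whose source has `Γ`-level `J` the word runs at levels `≤ min(J+1, k)` (`…N12BjRootChainsLam.exists_rootChain_lamBondsSeq_graded`),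
so `|Ω| ≤ m·L^{min(J+1,k)}`, `dist1 (𝒰_U(walk (root b₋) Ω)·g⁻¹) ≤ m·θ_{min(J+1,k)}`, `dist1 g ≤ m·δ₁`, `m = 3·d·(L−1)∕2 + 5` — the per-bond transporter budget of the graded first layer.
[cite: Balaban1984PropagatorsII, (2.3) p.224; Balaban1985Variational, (16)–(18) p.280; Balaban1985RegularSpaces, (1.7) p.77, (1.19) p.79; Balaban1985Averaging, (19)–(20) p.21; Balaban1988Convergent, (2.13) pp.256–257] -/
theorem rootTransporter_lamBondsSeq_graded (hk : k ≤ P.m + P.K) (hk1 : 1 ≤ k) (hM2 : 2 ≤ M₁) (hdiv : side P.L M₁ k ∣ P.sitesPerDir 0) (root : Site P 0 → Site P 0)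
    (hcentre : ∀ (z : Site P 0) (J : ℕ), iterBlockOf J z ∈ (Bj M₁ Z k : DetSet P) J →
      ((1 ≤ J ∧ ∃ c ∈ lamBondsSeq (maxDomT M₁ Z) k (J - 1), (iterBlockOf (J - 1) z = c.src ∨ iterBlockOf (J - 1) z = c.tgt)) ∧
          root z = embIter (J - 1) (iterBlockOf (J - 1) z)) ∨
      (¬ (1 ≤ J ∧ ∃ c ∈ lamBondsSeq (maxDomT M₁ Z) k (J - 1), (iterBlockOf (J - 1) z = c.src ∨ iterBlockOf (J - 1) z = c.tgt)) ∧
          root z = embIter J (iterBlockOf J z)))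
    (ℰ : LoopAverage G) (U : GaugeField P 0 G) (κ θ : ℕ → ℝ) (hθ0 : 0 ≤ θ 0) (hθ : ∀ i, κ i + P.L * θ i ≤ θ (i + 1)) (hθmono : ∀ i j, i ≤ j → θ i ≤ θ j)
    (hκ : ∀ i ≤ k, ∀ c ∈ lamBondsSeq (maxDomT M₁ Z) k i, ∀ i' < i, ∀ c' : PBond P (i' + 1), c'.dir = c.dir →
      (∃ t < P.L ^ i, embIter (i' + 1) c'.src = (fun z : Site P 0 => z.shift c.dir)^[t] (embIter i c.src)) →
      dist1 (corr ℰ (Averaging.iter (fun i => blockAvg (P := P) (j := i) ℰ) i' U) c') ≤ κ i')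
    {δ₁ : ℝ} (hδ₁ : ∀ i ≤ k, ∀ c ∈ lamBondsSeq (maxDomT M₁ Z) k i, dist1 (Averaging.iter (fun i => blockAvg (P := P) (j := i) ℰ) i U c) ≤ δ₁) :
    ∀ b : PBond P 0, b.src ∈ maxDomT M₁ Z 1 → b.tgt ∈ maxDomT M₁ Z 1 → root b.src ≠ root b.tgt →
      ∀ J : ℕ, iterBlockOf J b.src ∈ (Bj M₁ Z k : DetSet P) J →
      ∃ (Ωw : List (Letter P.d)) (g : G), walkEnd (root b.src) Ωw = root b.tgt ∧ Ωw.length ≤ (3 * (P.d * ((P.L - 1) / 2)) + 5) * P.L ^ min (J + 1) k ∧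
        dist1 (holAt U (walk (root b.src) Ωw) * g⁻¹) ≤ ((3 * (P.d * ((P.L - 1) / 2)) + 5 : ℕ) : ℝ) * θ (min (J + 1) k) ∧
        dist1 g ≤ ((3 * (P.d * ((P.L - 1) / 2)) + 5 : ℕ) : ℝ) * δ₁ := by
  intro b hbs hbt hne J hJ
  have hM : 1 ≤ M₁ := by omega
  obtain ⟨J', -, hJ'⟩ := hcov_Bj hM hk1 hk hdiv (Z := Z) b.tgt
  obtain ⟨links, hlen, hmem, hgrade, hend, hcons⟩ := exists_rootChain_lamBondsSeq_graded hk hk1 hM2 hdiv root hcentre b hbs hbt hJ hJ'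
  obtain ⟨g, hH, hg, hl⟩ := transporter_of_links ℰ U κ θ hθ0 hθ (fun i hi => hθmono i _ hi) (lamBondsSeq (maxDomT M₁ Z) k) hκ hδ₁ (root b.src) links hmem
    (fun l hl => le_min (hgrade l hl).1 (hmem l hl).1) hcons
  have hθJ0 : 0 ≤ θ (min (J + 1) k) := hθ0.trans (hθmono 0 _ (Nat.zero_le _))
  have hδ0 : (0 : ℝ) ≤ δ₁ ∨ links = [] := by
    rcases links with _ | ⟨l, ls⟩
    · exact Or.inr rfl
    · exact Or.inl ((GaugeGroup.dist1_nonneg _).trans (hδ₁ l.1 (hmem l (by simp)).1 l.2.1 (hmem l (by simp)).2))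
  have hlenR : (links.length : ℝ) ≤ ((3 * (P.d * ((P.L - 1) / 2)) + 5 : ℕ) : ℝ) := by exact_mod_cast hlen
  refine ⟨_, g, hend, hl.trans (Nat.mul_le_mul_right _ hlen), hH.trans (mul_le_mul_of_nonneg_right hlenR hθJ0), hg.trans ?_⟩
  rcases hδ0 with h0 | hnil
  · exact mul_le_mul_of_nonneg_right hlenR h0
  · subst hnil
    simp only [List.map_nil, List.flatten_nil, walkEnd] at hend
    exact absurd hend hne

/-- ★★ **THE HUB LETTERS (H1), (H2) AT PRINT's DATUM** — `N12RootTransporterBj.hubLetters_Bj` with (CENTRE), `hκ`, `hδ₁` read on print members (`0 ≤ δ₁`).  Hub of a site := the centre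
`ι_J(B^J x)` of its `Γ`-level block; (H1) every `x ∈ Ω₁(Z)` has a transporter datum `root x ⇝ hub x` with budgets `(m₁·L^k, m₁·θ_k, m₁·δ₁)`, `m₁ = d·(L−1)∕2 + 2` (at print's datum the
chain is EMPTY — `root x = hub x` —, the parent's budgets kept); (H2) every fine bond with both ends in `Ω₁(Z)` has one `hub b₋ ⇝ hub b₊` with budgets `(m₂·L^k, m₂·θ_k, m₂·δ₁)`,
`m₂ = d·(L−1)∕2 + 1` (`…N12BjRootChainsLam.exists_chain_centre_centre_lam`). [cite: Balaban1984PropagatorsII, (2.3) p.224; Balaban1985Variational, (3)–(4) p.278, (16)–(18) p.280; Balaban1985Averaging, (19)–(20) p.21; Balaban1988Convergent, (2.13) pp.256–257] -/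
theorem hubLetters_lamBondsSeq (hk : k ≤ P.m + P.K) (hk1 : 1 ≤ k) (hM2 : 2 ≤ M₁) (hdiv : side P.L M₁ k ∣ P.sitesPerDir 0) (root : Site P 0 → Site P 0)
    (hcentre : ∀ (z : Site P 0) (J : ℕ), iterBlockOf J z ∈ (Bj M₁ Z k : DetSet P) J →
      ((1 ≤ J ∧ ∃ c ∈ lamBondsSeq (maxDomT M₁ Z) k (J - 1), (iterBlockOf (J - 1) z = c.src ∨ iterBlockOf (J - 1) z = c.tgt)) ∧
          root z = embIter (J - 1) (iterBlockOf (J - 1) z)) ∨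
      (¬ (1 ≤ J ∧ ∃ c ∈ lamBondsSeq (maxDomT M₁ Z) k (J - 1), (iterBlockOf (J - 1) z = c.src ∨ iterBlockOf (J - 1) z = c.tgt)) ∧
          root z = embIter J (iterBlockOf J z)))
    (ℰ : LoopAverage G) (U : GaugeField P 0 G) (κ θ : ℕ → ℝ) (hθ0 : 0 ≤ θ 0) (hθ : ∀ i, κ i + P.L * θ i ≤ θ (i + 1)) (hθk : ∀ i ≤ k, θ i ≤ θ k)
    (hκ : ∀ i ≤ k, ∀ c ∈ lamBondsSeq (maxDomT M₁ Z) k i, ∀ i' < i, ∀ c' : PBond P (i' + 1), c'.dir = c.dir →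
      (∃ t < P.L ^ i, embIter (i' + 1) c'.src = (fun z : Site P 0 => z.shift c.dir)^[t] (embIter i c.src)) →
      dist1 (corr ℰ (Averaging.iter (fun i => blockAvg (P := P) (j := i) ℰ) i' U) c') ≤ κ i')
    {δ₁ : ℝ} (hδ0 : 0 ≤ δ₁) (hδ₁ : ∀ i ≤ k, ∀ c ∈ lamBondsSeq (maxDomT M₁ Z) k i, dist1 (Averaging.iter (fun i => blockAvg (P := P) (j := i) ℰ) i U c) ≤ δ₁) :
    ∃ hub : Site P 0 → Site P 0,
      (∀ (x : Site P 0) (J : ℕ), iterBlockOf J x ∈ (Bj M₁ Z k : DetSet P) J → hub x = embIter J (iterBlockOf J x)) ∧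
      (∀ x ∈ maxDomT M₁ Z 1, ∃ (Ωw : List (Letter P.d)) (g : G), walkEnd (root x) Ωw = hub x ∧ Ωw.length ≤ (P.d * ((P.L - 1) / 2) + 2) * P.L ^ k ∧
        dist1 (holAt U (walk (root x) Ωw) * g⁻¹) ≤ ((P.d * ((P.L - 1) / 2) + 2 : ℕ) : ℝ) * θ k ∧ dist1 g ≤ ((P.d * ((P.L - 1) / 2) + 2 : ℕ) : ℝ) * δ₁) ∧
      (∀ b : PBond P 0, b.src ∈ maxDomT M₁ Z 1 → b.tgt ∈ maxDomT M₁ Z 1 →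
        ∃ (Ωw : List (Letter P.d)) (g : G), walkEnd (hub b.src) Ωw = hub b.tgt ∧ Ωw.length ≤ (P.d * ((P.L - 1) / 2) + 1) * P.L ^ k ∧
          dist1 (holAt U (walk (hub b.src) Ωw) * g⁻¹) ≤ ((P.d * ((P.L - 1) / 2) + 1 : ℕ) : ℝ) * θ k ∧ dist1 g ≤ ((P.d * ((P.L - 1) / 2) + 1 : ℕ) : ℝ) * δ₁) := by
  classical
  have hM : 1 ≤ M₁ := by omega
  have hcov := hcov_Bj hM hk1 hk hdiv (Z := Z)
  have hθk0 : 0 ≤ θ k := hθ0.trans (hθk 0 (Nat.zero_le k))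
  -- the hub: the centre of the `Γ`-level block (the level is unique)
  refine ⟨fun x => embIter (Classical.choose (hcov x)) (iterBlockOf (Classical.choose (hcov x)) x), fun x J hJ => ?_, fun x hx => ?_, fun b hbs hbt => ?_⟩
  · have hspec := (Classical.choose_spec (hcov x)).2
    have hJJ : Classical.choose (hcov x) = J := N12BjCollarRoots.eq_of_iterBlockOf_mem_Bj hM hdiv hk hspec hJ
    subst hJJ
    rfl
  · set J := Classical.choose (hcov x)
    have hJ : iterBlockOf J x ∈ (Bj M₁ Z k : DetSet P) J := (Classical.choose_spec (hcov x)).2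
    have hJ1 : 1 ≤ J := by
      by_contra h
      have hJ0 : J = 0 := by omega
      rw [hJ0, Bj_zero (by omega)] at hJ
      exact hJ hx
    obtain ⟨⟨links, hlen, hmem, hend, hcons⟩, -⟩ := exists_chain_root_centre_lam hM2 hdiv hk hJ1 hJ root (hcentre x J hJ)
    obtain ⟨g, hH, hg, hl⟩ := transporter_of_links ℰ U κ θ hθ0 hθ hθk (lamBondsSeq (maxDomT M₁ Z) k) hκ hδ₁ (root x) links hmem (fun l hl => (hmem l hl).1) hcons
    have hlenR : (links.length : ℝ) ≤ ((P.d * ((P.L - 1) / 2) + 2 : ℕ) : ℝ) := by exact_mod_cast hlen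
    exact ⟨_, g, hend, hl.trans (Nat.mul_le_mul_right _ hlen), hH.trans (mul_le_mul_of_nonneg_right hlenR hθk0), hg.trans (mul_le_mul_of_nonneg_right hlenR hδ0)⟩
  · set J := Classical.choose (hcov b.src)
    have hJ : iterBlockOf J b.src ∈ (Bj M₁ Z k : DetSet P) J := (Classical.choose_spec (hcov b.src)).2
    set J' := Classical.choose (hcov b.tgt)
    have hJ' : iterBlockOf J' b.tgt ∈ (Bj M₁ Z k : DetSet P) J' := (Classical.choose_spec (hcov b.tgt)).2
    have hJ1 : 1 ≤ J := by
      by_contra h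
      have hJ0 : J = 0 := by omega
      rw [hJ0, Bj_zero (by omega)] at hJ
      exact hJ hbs
    obtain ⟨links, hlen, hmem, hend, hcons⟩ := exists_chain_centre_centre_lam hM2 hdiv hk b hJ1 hJ hJ'
    obtain ⟨g, hH, hg, hl⟩ := transporter_of_links ℰ U κ θ hθ0 hθ hθk (lamBondsSeq (maxDomT M₁ Z) k) hκ hδ₁ _ links hmem (fun l hl => (hmem l hl).1) hcons
    have hlenR : (links.length : ℝ) ≤ ((P.d * ((P.L - 1) / 2) + 1 : ℕ) : ℝ) := by exact_mod_cast hlen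
    exact ⟨_, g, hend, hl.trans (Nat.mul_le_mul_right _ hlen), hH.trans (mul_le_mul_of_nonneg_right hlenR hθk0), hg.trans (mul_le_mul_of_nonneg_right hlenR hδ0)⟩

/-- ★★★ **THE GRADED ROOT-TRANSPORTER LETTER FOR EVERY BOND TOUCHING `Ω₁(Z)` — CROSSING BONDS INCLUDED** (the lane's LOCATED-2).  Data as `rootTransporter_lamBondsSeq_graded`, but the
root map given in the (CENTRE)ᴸᵃᵐ shape «`root z = ι_J(B^J z)` whenever `B^J z ∈ Γ_J`» (`…N12TowerForestLam.exists_towerForest_rooted_lamBondsSeq`); for a fine bond `b` with AT LEAST ONE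
end in `Ω₁(Z)`, `root b₋ ≠ root b₊`, source of `Γ`-level `J`: a word from `root b₋` to `root b₊` of length `≤ m·L^{min(J+1,k)}` and `g` with `dist1 (𝒰_U(walk …)·g⁻¹) ≤ m·θ_{min(J+1,k)}`,
`dist1 g ≤ m·δ₁`, `m = 3·d·(L−1)∕2 + 5` — the chain `…N12BjRootChainsLam.exists_rootChain_lamBondsSeq_graded_touching` (for a crossing bond: the outward connector of level `1` and
`Λ₀`-links inside the outside block) read through `transporter_of_links`. [cite: Balaban1984PropagatorsII, (2.3) p.224; Balaban1985Variational, (16)–(18) p.280; Balaban1985RegularSpaces, (1.7) p.77, (1.19) p.79; Balaban1985Averaging, (19)–(20) p.21; Balaban1988Convergent, (2.13) pp.256–257] -/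
theorem rootTransporter_lamBondsSeq_graded_touching (hk : k ≤ P.m + P.K) (hk1 : 1 ≤ k) (hM2 : 2 ≤ M₁) (hdiv : side P.L M₁ k ∣ P.sitesPerDir 0) (root : Site P 0 → Site P 0)
    (hroot : ∀ (z : Site P 0) (J : ℕ), iterBlockOf J z ∈ (Bj M₁ Z k : DetSet P) J → root z = embIter J (iterBlockOf J z))
    (ℰ : LoopAverage G) (U : GaugeField P 0 G) (κ θ : ℕ → ℝ) (hθ0 : 0 ≤ θ 0) (hθ : ∀ i, κ i + P.L * θ i ≤ θ (i + 1)) (hθmono : ∀ i j, i ≤ j → θ i ≤ θ j)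
    (hκ : ∀ i ≤ k, ∀ c ∈ lamBondsSeq (maxDomT M₁ Z) k i, ∀ i' < i, ∀ c' : PBond P (i' + 1), c'.dir = c.dir →
      (∃ t < P.L ^ i, embIter (i' + 1) c'.src = (fun z : Site P 0 => z.shift c.dir)^[t] (embIter i c.src)) →
      dist1 (corr ℰ (Averaging.iter (fun i => blockAvg (P := P) (j := i) ℰ) i' U) c') ≤ κ i')
    {δ₁ : ℝ} (hδ₁ : ∀ i ≤ k, ∀ c ∈ lamBondsSeq (maxDomT M₁ Z) k i, dist1 (Averaging.iter (fun i => blockAvg (P := P) (j := i) ℰ) i U c) ≤ δ₁) :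
    ∀ b : PBond P 0, (b.src ∈ maxDomT M₁ Z 1 ∨ b.tgt ∈ maxDomT M₁ Z 1) → root b.src ≠ root b.tgt →
      ∀ J : ℕ, iterBlockOf J b.src ∈ (Bj M₁ Z k : DetSet P) J →
      ∃ (Ωw : List (Letter P.d)) (g : G), walkEnd (root b.src) Ωw = root b.tgt ∧ Ωw.length ≤ (3 * (P.d * ((P.L - 1) / 2)) + 5) * P.L ^ min (J + 1) k ∧
        dist1 (holAt U (walk (root b.src) Ωw) * g⁻¹) ≤ ((3 * (P.d * ((P.L - 1) / 2)) + 5 : ℕ) : ℝ) * θ (min (J + 1) k) ∧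
        dist1 g ≤ ((3 * (P.d * ((P.L - 1) / 2)) + 5 : ℕ) : ℝ) * δ₁ := by
  intro b hb hne J hJ
  have hM : 1 ≤ M₁ := by omega
  obtain ⟨J', -, hJ'⟩ := hcov_Bj hM hk1 hk hdiv (Z := Z) b.tgt
  obtain ⟨-, links, hlen, hmem, hend, hcons⟩ := exists_rootChain_lamBondsSeq_graded_touching hk hk1 hM2 hdiv b hb hJ hJ'
  have hrs : root b.src = embIter J (iterBlockOf J b.src) := hroot b.src J hJ
  have hrt : root b.tgt = embIter J' (iterBlockOf J' b.tgt) := hroot b.tgt J' hJ'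
  rw [hrs, hrt] at hne ⊢
  obtain ⟨g, hH, hg, hl⟩ := transporter_of_links ℰ U κ θ hθ0 hθ (fun i hi => hθmono i _ hi) (lamBondsSeq (maxDomT M₁ Z) k) hκ hδ₁
    (embIter J (iterBlockOf J b.src)) links (fun l hl => (hmem l hl).2.2) (fun l hl => le_min (hmem l hl).1 (hmem l hl).2.2.1) hcons
  have hθJ0 : 0 ≤ θ (min (J + 1) k) := hθ0.trans (hθmono 0 _ (Nat.zero_le _))
  have hδ0 : (0 : ℝ) ≤ δ₁ ∨ links = [] := by
    rcases links with _ | ⟨l, ls⟩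
    · exact Or.inr rfl
    · exact Or.inl ((GaugeGroup.dist1_nonneg _).trans (hδ₁ l.1 (hmem l (by simp)).2.2.1 l.2.1 (hmem l (by simp)).2.2.2))
  have hlen' : links.length ≤ 3 * (P.d * ((P.L - 1) / 2)) + 5 := hlen.trans (by omega)
  have hlenR : (links.length : ℝ) ≤ ((3 * (P.d * ((P.L - 1) / 2)) + 5 : ℕ) : ℝ) := by exact_mod_cast hlen'
  refine ⟨_, g, hend, hl.trans (Nat.mul_le_mul_right _ hlen'), hH.trans (mul_le_mul_of_nonneg_right hlenR hθJ0), hg.trans ?_⟩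
  rcases hδ0 with h0 | hnil
  · exact mul_le_mul_of_nonneg_right hlenR h0
  · subst hnil
    simp only [List.map_nil, List.flatten_nil, walkEnd] at hend
    exact absurd hend hne

end Record

end Summit.QuantumFields.YangMills.BalabanUVNodes.N12RootTransporterBjLam

end
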